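import Mathlib
import Literature.MathematicalPhysics.QuantumFieldTheory.Balaban1983to89.Beta.ExpKernelCalculus
import Literature.MathematicalPhysics.QuantumFieldTheory.Balaban1983to89.Beta.OneStepResolventKernel
import Literature.MathematicalPhysics.QuantumFieldTheory.Balaban1983to89.B12Beta

/-!
# Road «FP» (binder row D1), REP∞ algebra layer (ALG-0/ALG-1 of `HOME/b2b-balaban-beta-d1-p3/REP-DESIGN.md`)

Bookkeeping identities for the one-loop kernel `hessKer A V W μ ν z = ½·tadpole A (W μ 0 ν z) − ½·bubble A (V μ 0) (V ν z)`
(`ExpKernelCalculus`), needed to represent the perfect coefficient by a window sum of leg bilinears: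

* §1 (ALG-0) the split of the (1.22)-second moment `secondMoment (hessKer A V W) μ ν` into the tadpole and bubble moments;
* §2 weighted superpositions `wsum w S` (`OneStepResolventKernel.wsum`) pass through `comp` (right slot) — Fubini for the
  lattice series under DOMINATION (decaying `A`, stencils bi-localised at their own index, bounded weights):
  `comp_wsum_right : comp A (wsum w S) = wsum w (u ↦ comp A (S u))`.
(The left slot, the trace, and the bilinear expansion of the bubble — ALG-1 — follow in `FP/RepAlgebraBubble.lean`.)

Generic in the dimension `D` and the fibre `F`; [folklore] throughout; nothing about Bałaban's operators is asserted.
HONEST FRAMING: bookkeeping toward `hident` (GAPS O-asym1-7); discharges nothing of `BetaPertH`; NOT the continuum limit, NOT Clay.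
-/

noncomputable section

open Finset Filter Topology
open scoped BigOperators

namespace Summit.QuantumFields.BalabanUV.Beta.FP.RepAlgebra

open Literature.MathematicalPhysics.QuantumFieldTheory.Balaban1983to89
open Literature.MathematicalPhysics.QuantumFieldTheory.Balaban1983to89.B12Sec2to5 (l1 l1_nonneg summable_exp_neg_l1)
open Literature.MathematicalPhysics.QuantumFieldTheory.Balaban1983to89.Beta.ExpKernelCalculus
open Literature.MathematicalPhysics.QuantumFieldTheory.Balaban1983to89.Beta.OneStepResolventKernel (wsum)

variable {D : ℕ} {F : Type*} [Fintype F]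

/-! ## §1 (ALG-0) The second moment of the one-loop kernel splits into tadpole and bubble moments -/

/-- [folklore] **ALG-0.**  If the tadpole channel `z ↦ tadpole A (W μ 0 ν z)·z_μz_ν` and the bubble channel
`z ↦ bubble A (V μ 0) (V ν z)·z_μz_ν` are summable, the (1.22)-second moment of `hessKer A V W` is
`½·Σ' (tadpole)·z_μz_ν − ½·Σ' (bubble)·z_μz_ν`. -/
theorem secondMoment_hessKer_split (A : MKer D F) (V : Fin D → Site D → MKer D F)
    (W : Fin D → Site D → Fin D → Site D → MKer D F) (μ ν : Fin D)
    (ht : Summable fun z : Site D => tadpole A (W μ 0 ν z) * (z μ : ℝ) * (z ν : ℝ))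
    (hb : Summable fun z : Site D => bubble A (V μ 0) (V ν z) * (z μ : ℝ) * (z ν : ℝ)) :
    B12Beta.secondMoment (hessKer A V W) μ ν
      = (1 / 2) * ∑' z : Site D, tadpole A (W μ 0 ν z) * (z μ : ℝ) * (z ν : ℝ)
        - (1 / 2) * ∑' z : Site D, bubble A (V μ 0) (V ν z) * (z μ : ℝ) * (z ν : ℝ) := by
  unfold B12Beta.secondMoment hessKer
  have e : ∀ z : Site D,
      ((1 / 2 : ℝ) * tadpole A (W μ 0 ν z) - 1 / 2 * bubble A (V μ 0) (V ν z)) * (z μ : ℝ) * (z ν : ℝ)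
        = (1 / 2) * (tadpole A (W μ 0 ν z) * (z μ : ℝ) * (z ν : ℝ))
          - (1 / 2) * (bubble A (V μ 0) (V ν z) * (z μ : ℝ) * (z ν : ℝ)) := fun z => by ring
  simp_rw [e]
  rw [(ht.mul_left (1 / 2)).tsum_sub (hb.mul_left (1 / 2)), tsum_mul_left, tsum_mul_left]

/-! ## §2 Superpositions pass through `comp` and `tr` (dominated Fubini) -/

section Dominated

variable {A : MKer D F} {C δ : ℝ} {S : Site D → MKer D F} {w : Site D → ℝ} {Cs δs Cw : ℝ}

/-- [folklore] Domination of the `comp`-superposition double family (right slot): for a decaying `A`, stencils `S u` bi-localised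
at `(u,u)` and bounded weights, `(y,u) ↦ Σ_f A x y a f · (w u · S u y z f b)` is bounded by the product of two summable
one-variable majorants `cardF·C·Cw·Cs · e^{−δ|x−y|₁} · e^{−δs|z−u|₁}`. -/
theorem abs_compWsumTerm_le (hA : Decays A C δ) (hS : ∀ u, BiLoc (S u) u u Cs δs) (hδs : 0 ≤ δs)
    (hw : ∀ u, |w u| ≤ Cw) (x z : Site D) (a b : F) (y u : Site D) :
    |∑ f, A x y a f * (w u * S u y z f b)|
      ≤ (Fintype.card F : ℝ) * (C * Cw * Cs) * (Real.exp (-δ * l1 (x - y)) * Real.exp (-δs * l1 (z - u))) := by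
  have hC : 0 ≤ C := hA.nonneg a
  have hCs : 0 ≤ Cs := (hS u).nonneg a
  have hCw : 0 ≤ Cw := (abs_nonneg _).trans (hw u)
  calc |∑ f, A x y a f * (w u * S u y z f b)|
      ≤ ∑ f, |A x y a f * (w u * S u y z f b)| := Finset.abs_sum_le_sum_abs _ _
    _ ≤ ∑ _f : F, (C * Cw * Cs) * (Real.exp (-δ * l1 (x - y)) * Real.exp (-δs * l1 (z - u))) := by
        refine Finset.sum_le_sum fun f _ => ?_
        rw [abs_mul, abs_mul]
        have h1 := hA x y a f
        have h2 := hw u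
        have h3 : |S u y z f b| ≤ Cs * Real.exp (-δs * l1 (z - u)) := by
          refine (hS u y z f b).trans (mul_le_mul_of_nonneg_left (Real.exp_le_exp.2 ?_) hCs)
          nlinarith [l1_nonneg (y - u)]
        calc |A x y a f| * (|w u| * |S u y z f b|)
            ≤ (C * Real.exp (-δ * l1 (x - y))) * (Cw * (Cs * Real.exp (-δs * l1 (z - u)))) :=
              mul_le_mul h1 (mul_le_mul h2 h3 (abs_nonneg _) hCw) (by positivity) (by positivity)
          _ = (C * Cw * Cs) * (Real.exp (-δ * l1 (x - y)) * Real.exp (-δs * l1 (z - u))) := by ring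
    _ = (Fintype.card F : ℝ) * (C * Cw * Cs) * (Real.exp (-δ * l1 (x - y)) * Real.exp (-δs * l1 (z - u))) := by
        rw [Finset.sum_const, Finset.card_univ, nsmul_eq_mul]; ring

/-- [folklore] The `comp`-superposition double family (right slot) is summable on `Site D × Site D`. -/
theorem summable_compWsumTerm (hA : Decays A C δ) (hδ : 0 < δ) (hS : ∀ u, BiLoc (S u) u u Cs δs) (hδs : 0 < δs)
    (hw : ∀ u, |w u| ≤ Cw) (x z : Site D) (a b : F) :
    Summable fun yu : Site D × Site D => ∑ f, A x yu.1 a f * (w yu.2 * S yu.2 yu.1 z f b) := by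
  have hprod : Summable fun yu : Site D × Site D =>
      Real.exp (-δ * l1 (x - yu.1)) * Real.exp (-δs * l1 (z - yu.2)) :=
    summable_mul_of_summable_norm (f := fun y : Site D => Real.exp (-δ * l1 (x - y)))
      (g := fun u : Site D => Real.exp (-δs * l1 (z - u)))
      (by simpa only [Real.norm_eq_abs, abs_of_nonneg (Real.exp_nonneg _)] using summable_exp_shift hδ x)
      (by simpa only [Real.norm_eq_abs, abs_of_nonneg (Real.exp_nonneg _)] using summable_exp_shift hδs z)
  refine Summable.of_norm_bounded (hprod.mul_left ((Fintype.card F : ℝ) * (C * Cw * Cs))) fun yu => ?_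
  rw [Real.norm_eq_abs]
  exact abs_compWsumTerm_le hA hS hδs.le hw x z a b yu.1 yu.2

omit [Fintype F] in
/-- [folklore] One `f`-summand of the superposition series is summable in the stencil index `u`. -/
theorem summable_mul_wsumTerm (hS : ∀ u, BiLoc (S u) u u Cs δs) (hδs : 0 < δs) (hw : ∀ u, |w u| ≤ Cw)
    (x y z : Site D) (a f b : F) :
    Summable fun u : Site D => A x y a f * (w u * S u y z f b) := by
  have hCs : 0 ≤ Cs := (hS 0).nonneg a
  have hCw : 0 ≤ Cw := (abs_nonneg _).trans (hw 0)
  refine Summable.of_norm_bounded ((summable_exp_shift hδs z).mul_left (|A x y a f| * (Cw * Cs))) fun u => ?_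
  rw [Real.norm_eq_abs, abs_mul, abs_mul, mul_assoc]
  refine mul_le_mul_of_nonneg_left ?_ (abs_nonneg _)
  have h3 : |S u y z f b| ≤ Cs * Real.exp (-δs * l1 (z - u)) := by
    refine (hS u y z f b).trans (mul_le_mul_of_nonneg_left (Real.exp_le_exp.2 ?_) hCs)
    nlinarith [l1_nonneg (y - u), hδs.le]
  calc |w u| * |S u y z f b| ≤ Cw * (Cs * Real.exp (-δs * l1 (z - u))) := mul_le_mul (hw u) h3 (abs_nonneg _) hCw
    _ = Cw * Cs * Real.exp (-δs * l1 (z - u)) := by ring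

/-- [folklore] **`comp` through a superposition, right slot**: `comp A (wsum w S) = wsum w (u ↦ comp A (S u))` entrywise
(decaying `A`, stencils bi-localised at their own index, bounded weights). -/
theorem comp_wsum_right (hA : Decays A C δ) (hδ : 0 < δ) (hS : ∀ u, BiLoc (S u) u u Cs δs) (hδs : 0 < δs)
    (hw : ∀ u, |w u| ≤ Cw) :
    comp A (wsum w S) = wsum w (fun u => comp A (S u)) := by
  funext x z a b
  -- the double family and its fibres
  set G : Site D → Site D → ℝ := fun y u => ∑ f, A x y a f * (w u * S u y z f b) with hG
  have hsum : Summable (Function.uncurry G) := summable_compWsumTerm hA hδ hS hδs hw x z a b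
  have hy : ∀ y, Summable (G y) := fun y => hsum.prod_factor y
  have hu : ∀ u, Summable fun y => G y u := fun u => hsum.prod_symm.prod_factor u
  -- left side = Σ'_y Σ'_u G y u
  have eL : comp A (wsum w S) x z a b = ∑' y, ∑' u, G y u := by
    show (∑' y, ∑ f, A x y a f * ∑' u, w u * S u y z f b) = ∑' y, ∑' u, G y u
    refine tsum_congr fun y => ?_
    rw [hG, Summable.tsum_finsetSum fun f _ => summable_mul_wsumTerm hS hδs hw x y z a f b]
    exact Finset.sum_congr rfl fun f _ => (tsum_mul_left).symm
  -- right side = Σ'_u Σ'_y G y u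
  have eR : wsum w (fun u => comp A (S u)) x z a b = ∑' u, ∑' y, G y u := by
    show (∑' u, w u * ∑' y, ∑ f, A x y a f * S u y z f b) = ∑' u, ∑' y, G y u
    refine tsum_congr fun u => ?_
    rw [← tsum_mul_left]
    refine tsum_congr fun y => ?_
    rw [hG, Finset.mul_sum]
    exact Finset.sum_congr rfl fun f _ => by ring
  rw [eL, eR]
  exact (hsum.tsum_comm' hy hu).symm

end Dominated

end Summit.QuantumFields.BalabanUV.Beta.FP.RepAlgebra

end
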